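import Mathlib
import HarnessLib
import Summits.Schanuel.Schanuel.Theorems.SoloBlindApproximantPowers
import Summits.Schanuel.Schanuel.Theorems.SoloBlindLacunaryApproximants

/-!
# Proposition NG″ — the construction, kernel form (solo-Schanuel-blind, session 6)

This file formalises the construction half of Proposition NG″ of
`run/shared/lean/ideation/Schanuel/solo-blind/paper/nogo.md` §6 (previously prose + exact integer
bookkeeping `work/nogo2_check.py`): there is ONE real number `x` such that for every profile
`(δ, σ, u)` of positive reals with

  `4 (u - σ) < σ`  and  `2 (u - δ) < σ`

(hypothesis (H2) `σ < 2δ` of the prose version is redundant) and every large `N` there are two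
non-zero integer polynomials `M₁, M₂ ∈ ℤ[X]` of degree `≤ N^δ`, coefficients `≤ exp(N^σ)` in
absolute value, with `0 < |Mᵢ(x)| ≤ exp(-N^u)` and NO common complex zero. Consequently no
criterion reading only degrees, heights, sizes at the point and zero-freeness of a family of
integer polynomials can conclude transcendence degree `≥ l` for any `l ≥ 2` anywhere in that
region: the point `θ = (x, 1, …, 1)` has transcendence degree `≤ 1` and carries such a family at
every scale. The region contains Roy's whole admissible window (`royAdmissible_profile_nogo₂`,
`SoloBlindProfileNoGoRankTwo.lean`).

## The construction

`x = ∑_k 2^{-a_k}` with `a_0 = 2`, `a_{k+1} = a_k²`, approximants `p_k / q_k`, `q_k = 2^{a_k}`,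
`p_k = ∑_{j ≤ k} 2^{a_k - a_j}`, with `0 < q_k x - p_k ≤ 2 · 2^{a_k} · 2^{-a_{k+1}}`
(`SoloBlindLacunaryApproximants.lean`, module K1). At scale `N` put `R = N^σ / (4 log 2)` and pick
the index `i` with `a_{i+1} ≤ R < a_{i+2}` (`exists_scale`); the witnesses are
`M₁ = (q_{i+1} X - p_{i+1})^j`, `M₂ = (q_i X - p_i)^{j'}` with exponents chosen by
`scale_exponents` below; their coefficients, values and common zeros are controlled by module K2
(`SoloBlindApproximantPowers.lean`: `abs_coeff_linear_pow_le`, `aeval_linear_pow`,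
`linear_pow_no_common_root`), packaged as `linear_pow_witness`; the three largeness conditions on
`N` are discharged by `eventually_scale_conditions` (`rpow` asymptotics: `4(u-σ) < σ` gives
`8 N^u ≤ N^σ R^{1/4}`, `2(u-δ) < σ` gives `2 N^u / (R^{1/2} log 2) + 1 ≤ N^δ`).

Main statements: `profile_nogo_rank_two_construction'` (strong form, without (H2)) and
`profile_nogo_rank_two_construction` (the form stated in `paper/nogo.md` §6). No definitions are
introduced; the sequence `a` is instantiated by `fun k => 2 ^ (2 ^ k)` in the assembly.
-/

namespace Summit.Schanuel.Schanuel.Theorems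

open Polynomial Finset Filter

section K3a

/-- A natural number between real bounds `ℓ ≥ 0` and `m ≥ ℓ + 1`. -/
theorem exists_nat_between_of_add_one_le {ℓ m : ℝ} (hℓ : 0 ≤ ℓ) (h : ℓ + 1 ≤ m) :
    ∃ j : ℕ, 1 ≤ j ∧ ℓ ≤ (j : ℝ) ∧ (j : ℝ) ≤ m := by
  have hm : 0 ≤ m := by linarith
  refine ⟨⌊m⌋₊, ?_, ?_, Nat.floor_le hm⟩
  · have : (0:ℝ) < ⌊m⌋₊ := by
      have := Nat.sub_one_lt_floor m
      exact_mod_cast (show (0:ℝ) < (⌊m⌋₊ : ℝ) by linarith)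
    exact_mod_cast this
  · have := Nat.sub_one_lt_floor m
    linarith

/-- Packaging: the power `(qX - p)^j` of an integer linear form as a profile witness. -/
theorem linear_pow_witness {p q : ℤ} {x : ℝ} {j n : ℕ} {E S U : ℝ} (hq : q ≠ 0)
    (hjE : (j : ℝ) ≤ E) (hpq : |p| + |q| ≤ 2 ^ n) (hS : (j : ℝ) * ((n : ℝ) * Real.log 2) ≤ S)
    (hpos : 0 < (q : ℝ) * x - p) (hU : (j : ℝ) * Real.log ((q : ℝ) * x - p) ≤ -U) :
    (C q * X - C p) ^ j ≠ 0 ∧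
    ((((C q * X - C p) ^ j).natDegree : ℕ) : ℝ) ≤ E ∧
    (∀ i, (|((C q * X - C p) ^ j).coeff i| : ℝ) ≤ Real.exp S) ∧
    0 < |aeval x ((C q * X - C p) ^ j)| ∧ |aeval x ((C q * X - C p) ^ j)| ≤ Real.exp (-U) := by
  have hlin : (C q * X - C p) ≠ 0 := by
    intro h
    have := congrArg (fun f : ℤ[X] => f.coeff 1) h
    simp only [coeff_sub, coeff_C_mul, coeff_X_one, mul_one, coeff_C, one_ne_zero, if_false,
      sub_zero, coeff_zero] at this
    exact hq this
  refine ⟨pow_ne_zero _ hlin, ?_, ?_, ?_, ?_⟩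
  · -- degree
    have h1 : (C q * X - C p).natDegree ≤ 1 := by
      rw [sub_eq_add_neg, ← C_neg]; exact natDegree_linear_le
    have h2 : ((C q * X - C p) ^ j).natDegree ≤ j := by
      calc ((C q * X - C p) ^ j).natDegree ≤ j * (C q * X - C p).natDegree := natDegree_pow_le
        _ ≤ j * 1 := Nat.mul_le_mul_left _ h1
        _ = j := mul_one j
    calc ((((C q * X - C p) ^ j).natDegree : ℕ) : ℝ) ≤ (j : ℝ) := by exact_mod_cast h2
      _ ≤ E := hjE
  · -- heights
    intro i
    have h1 : |((C q * X - C p) ^ j).coeff i| ≤ (|p| + |q|) ^ j := abs_coeff_linear_pow_le p q j i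
    have h2 : (|p| + |q|) ^ j ≤ ((2:ℤ) ^ n) ^ j :=
      pow_le_pow_left₀ (by positivity) hpq j
    have h3 : ((|((C q * X - C p) ^ j).coeff i| : ℤ) : ℝ) ≤ (((2:ℤ) ^ n) ^ j : ℤ) := by
      exact_mod_cast h1.trans h2
    rw [← Int.cast_abs]
    refine h3.trans ?_
    push_cast
    rw [← pow_mul, ← Real.exp_log (by positivity : (0:ℝ) < 2 ^ (n * j)), Real.exp_le_exp,
      Real.log_pow]
    push_cast
    nlinarith [Real.log_pos (by norm_num : (1:ℝ) < 2)]
  · -- non-vanishing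
    rw [aeval_linear_pow, abs_pos]
    exact pow_ne_zero _ (ne_of_gt hpos)
  · -- smallness
    rw [aeval_linear_pow, abs_of_pos (pow_pos hpos j), ← Real.log_le_iff_le_exp (pow_pos hpos j),
      Real.log_pow]
    exact hU

/-- Per-scale exponent arithmetic. With `c = log 2`, `B ≥ 4`, `A = B²`, budget `S`, demand `U`,
degree cap `E`: if `4Ac ≤ S`, `8U ≤ SB` and `2U/(B²c) + 1 ≤ E`, suitable exponents `j` (for the
approximant with exponent `A`, next exponent `A²`) and `j'` (exponent `B`, next `A`) exist. -/
theorem scale_exponents {S U E A B : ℝ} (hS : 0 < S) (hU : 0 ≤ U) (hB : 4 ≤ B) (hA : A = B ^ 2)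
    (h1 : 4 * A * Real.log 2 ≤ S) (h2 : 8 * U ≤ S * B)
    (h3 : 2 * U / (B ^ 2 * Real.log 2) + 1 ≤ E) :
    (∃ j : ℕ, 1 ≤ j ∧ (j : ℝ) ≤ E ∧ (j : ℝ) * ((A + 1) * Real.log 2) ≤ S ∧
        U ≤ (j : ℝ) * ((A ^ 2 - A - 1) * Real.log 2)) ∧
    (∃ j' : ℕ, 1 ≤ j' ∧ (j' : ℝ) ≤ E ∧ (j' : ℝ) * ((B + 1) * Real.log 2) ≤ S ∧
        U ≤ (j' : ℝ) * ((A - B - 1) * Real.log 2)) := by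
  have hc : 0 < Real.log 2 := Real.log_pos (by norm_num)
  have hc1 : Real.log 2 < 1 := by
    have := Real.log_two_lt_d9; linarith
  have hBA : B ≤ A := by rw [hA]; nlinarith
  have hA16 : 16 ≤ A := by rw [hA]; nlinarith
  have hB0 : 0 < B := by linarith
  have hA0 : 0 < A := by linarith
  constructor
  · -- j for the pair (A, A²)
    have hℓ : 0 ≤ 2 * U / (A ^ 2 * Real.log 2) := by positivity
    have hm : 2 * U / (A ^ 2 * Real.log 2) + 1 ≤ min E (S / (2 * A * Real.log 2)) := by
      refine le_min ?_ ?_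
      · refine le_trans ?_ h3
        gcongr
      · rw [div_add_one (by positivity), div_le_div_iff₀ (by positivity) (by positivity)]
        have : 8 * U ≤ S * A := h2.trans (by nlinarith)
        nlinarith [mul_le_mul_of_nonneg_left this (le_of_lt (mul_pos hA0 hc)),
          mul_le_mul_of_nonneg_left h1 (le_of_lt (mul_pos (mul_pos hA0 hA0) hc))]
    obtain ⟨j, hj1, hjl, hjm⟩ := exists_nat_between_of_add_one_le hℓ hm
    refine ⟨j, hj1, hjm.trans (min_le_left _ _), ?_, ?_⟩
    · have : (j : ℝ) ≤ S / (2 * A * Real.log 2) := hjm.trans (min_le_right _ _)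
      rw [le_div_iff₀ (by positivity)] at this
      have hj0 : (0 : ℝ) ≤ j := by positivity
      have key := mul_le_mul_of_nonneg_left (by linarith : A + 1 ≤ 2 * A) (mul_nonneg hj0 hc.le)
      calc (j : ℝ) * ((A + 1) * Real.log 2) = (j * Real.log 2) * (A + 1) := by ring
        _ ≤ (j * Real.log 2) * (2 * A) := key
        _ = j * (2 * A * Real.log 2) := by ring
        _ ≤ S := this
    · rw [div_le_iff₀ (by positivity)] at hjl
      have hj0 : (0 : ℝ) ≤ j := by positivity
      have : A ^ 2 / 2 ≤ A ^ 2 - A - 1 := by nlinarith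
      have key := mul_le_mul_of_nonneg_left this (mul_nonneg hj0 hc.le)
      calc U ≤ j * (A ^ 2 * Real.log 2) / 2 := by linarith
        _ = (j * Real.log 2) * (A ^ 2 / 2) := by ring
        _ ≤ (j * Real.log 2) * (A ^ 2 - A - 1) := key
        _ = j * ((A ^ 2 - A - 1) * Real.log 2) := by ring
  · -- j' for the pair (B, A)
    have hℓ : 0 ≤ 2 * U / (B ^ 2 * Real.log 2) := by positivity
    have hm : 2 * U / (B ^ 2 * Real.log 2) + 1 ≤ min E (S / (2 * B * Real.log 2)) := by
      refine le_min h3 ?_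
      rw [div_add_one (by positivity), div_le_div_iff₀ (by positivity) (by positivity)]
      have hB2 : 4 * B ^ 2 * Real.log 2 ≤ S := by
        rw [hA] at h1; nlinarith [mul_pos (mul_pos hB0 hB0) hc]
      nlinarith [mul_le_mul_of_nonneg_left h2 (le_of_lt (mul_pos hB0 hc)),
        mul_le_mul_of_nonneg_left hB2 (le_of_lt (mul_pos hB0 hc)),
        mul_le_mul_of_nonneg_left hB (by positivity : (0:ℝ) ≤ S * B * Real.log 2)]
    obtain ⟨j, hj1, hjl, hjm⟩ := exists_nat_between_of_add_one_le hℓ hm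
    refine ⟨j, hj1, hjm.trans (min_le_left _ _), ?_, ?_⟩
    · have : (j : ℝ) ≤ S / (2 * B * Real.log 2) := hjm.trans (min_le_right _ _)
      rw [le_div_iff₀ (by positivity)] at this
      have hj0 : (0 : ℝ) ≤ j := by positivity
      have key := mul_le_mul_of_nonneg_left (by linarith : B + 1 ≤ 2 * B) (mul_nonneg hj0 hc.le)
      calc (j : ℝ) * ((B + 1) * Real.log 2) = (j * Real.log 2) * (B + 1) := by ring
        _ ≤ (j * Real.log 2) * (2 * B) := key
        _ = j * (2 * B * Real.log 2) := by ring
        _ ≤ S := this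
    · rw [div_le_iff₀ (by positivity)] at hjl
      have hj0 : (0 : ℝ) ≤ j := by positivity
      have : B ^ 2 / 2 ≤ A - B - 1 := by rw [hA]; nlinarith
      have key := mul_le_mul_of_nonneg_left this (mul_nonneg hj0 hc.le)
      calc U ≤ j * (B ^ 2 * Real.log 2) / 2 := by linarith
        _ = (j * Real.log 2) * (B ^ 2 / 2) := by ring
        _ ≤ (j * Real.log 2) * (A - B - 1) := key
        _ = j * ((A - B - 1) * Real.log 2) := by ring

end K3a

section K3b

/-- Eventual domination of real powers: `K x^{e₁} ≤ x^{e₂}` for large `x` when `e₁ < e₂`. -/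
theorem eventually_mul_rpow_le_rpow (K : ℝ) {e₁ e₂ : ℝ} (h : e₁ < e₂) :
    ∀ᶠ x : ℝ in atTop, K * x ^ e₁ ≤ x ^ e₂ := by
  have h1 : ∀ᶠ x : ℝ in atTop, K ≤ x ^ (e₂ - e₁) :=
    (tendsto_rpow_atTop (by linarith)).eventually_ge_atTop K
  filter_upwards [h1, eventually_gt_atTop 0] with x hx hx0
  calc K * x ^ e₁ ≤ x ^ (e₂ - e₁) * x ^ e₁ :=
        mul_le_mul_of_nonneg_right hx (Real.rpow_nonneg hx0.le _)
    _ = x ^ e₂ := by rw [← Real.rpow_add hx0, sub_add_cancel]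

/-- Variant with `+ 1`: `K x^{e₁} + 1 ≤ x^{e₂}` for large `x` when `e₁ < e₂` and `0 < e₂`. -/
theorem eventually_mul_rpow_add_one_le_rpow (K : ℝ) {e₁ e₂ : ℝ} (h : e₁ < e₂) (h2 : 0 < e₂) :
    ∀ᶠ x : ℝ in atTop, K * x ^ e₁ + 1 ≤ x ^ e₂ := by
  have hA := eventually_mul_rpow_le_rpow (2 * K) h
  have hB : ∀ᶠ x : ℝ in atTop, (2:ℝ) ≤ x ^ e₂ := (tendsto_rpow_atTop h2).eventually_ge_atTop 2
  filter_upwards [hA, hB] with x hx hx'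
  linarith

/-- The three largeness conditions on the scale `N` used by the construction, in the form
consumed by `scale_exponents`, hold for all large `N` under (H1) `4(u-σ) < σ` and (H3)
`2(u-δ) < σ`. -/
theorem eventually_scale_conditions {δ σ u : ℝ} (hδ : 0 < δ) (hσ : 0 < σ)
    (H1 : 4 * (u - σ) < σ) (H3 : 2 * (u - δ) < σ) :
    ∃ N₀ : ℕ, ∀ N : ℕ, N₀ ≤ N →
      64 * Real.log 2 ≤ (N : ℝ) ^ σ ∧
      8 * (N : ℝ) ^ u ≤ (N : ℝ) ^ σ * ((N : ℝ) ^ σ / (4 * Real.log 2)) ^ (4 : ℝ)⁻¹ ∧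
      2 * (N : ℝ) ^ u / (((N : ℝ) ^ σ / (4 * Real.log 2)) ^ (2 : ℝ)⁻¹ * Real.log 2) + 1
        ≤ (N : ℝ) ^ δ := by
  have hc : 0 < Real.log 2 := Real.log_pos (by norm_num)
  set c := Real.log 2 with hc_def
  have e0 : ∀ᶠ x : ℝ in atTop, 64 * c ≤ x ^ σ := (tendsto_rpow_atTop hσ).eventually_ge_atTop _
  have e1 : ∀ᶠ x : ℝ in atTop, (8 * (4 * c) ^ (4 : ℝ)⁻¹) * x ^ u ≤ x ^ (σ + σ * (4 : ℝ)⁻¹) :=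
    eventually_mul_rpow_le_rpow _ (by linarith)
  have e2 : ∀ᶠ x : ℝ in atTop,
      (2 * (4 * c) ^ (2 : ℝ)⁻¹ / c) * x ^ (u - σ * (2 : ℝ)⁻¹) + 1 ≤ x ^ δ :=
    eventually_mul_rpow_add_one_le_rpow _ (by linarith) hδ
  have e : ∀ᶠ x : ℝ in atTop, 64 * c ≤ x ^ σ ∧
      8 * x ^ u ≤ x ^ σ * (x ^ σ / (4 * c)) ^ (4 : ℝ)⁻¹ ∧
      2 * x ^ u / ((x ^ σ / (4 * c)) ^ (2 : ℝ)⁻¹ * c) + 1 ≤ x ^ δ := by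
    filter_upwards [e0, e1, e2, eventually_gt_atTop 0] with x h0 h1 h2 hx
    refine ⟨h0, ?_, ?_⟩
    · have : x ^ σ * (x ^ σ / (4 * c)) ^ (4 : ℝ)⁻¹
          = x ^ (σ + σ * (4 : ℝ)⁻¹) / (4 * c) ^ (4 : ℝ)⁻¹ := by
        rw [Real.div_rpow (Real.rpow_nonneg hx.le _) (by positivity), ← Real.rpow_mul hx.le,
          Real.rpow_add hx]
        ring
      rw [this, le_div_iff₀ (by positivity)]
      linarith
    · have : 2 * x ^ u / ((x ^ σ / (4 * c)) ^ (2 : ℝ)⁻¹ * c)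
          = (2 * (4 * c) ^ (2 : ℝ)⁻¹ / c) * x ^ (u - σ * (2 : ℝ)⁻¹) := by
        rw [Real.div_rpow (Real.rpow_nonneg hx.le _) (by positivity), ← Real.rpow_mul hx.le,
          Real.rpow_sub hx]
        have h4 : (0:ℝ) < (4 * c) ^ (2 : ℝ)⁻¹ := by positivity
        have h5 : (0:ℝ) < x ^ (σ * (2 : ℝ)⁻¹) := by positivity
        field_simp
      rw [this]
      exact h2
  obtain ⟨N₀, hN₀⟩ := eventually_atTop.mp (tendsto_natCast_atTop_atTop.eventually e)
  exact ⟨N₀, hN₀⟩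

end K3b

section Assembly

/-- **Proposition NG″ (construction half), strong form** — hypothesis (H2) `σ < 2δ` of
`paper/nogo.md` §6 is not needed. -/
theorem profile_nogo_rank_two_construction' :
    ∃ x : ℝ, ∀ δ σ u : ℝ, 0 < δ → 0 < σ → 0 < u →
      4 * (u - σ) < σ → 2 * (u - δ) < σ →
      ∃ N₀ : ℕ, ∀ N : ℕ, N₀ ≤ N →
        ∃ M₁ M₂ : ℤ[X],
          M₁ ≠ 0 ∧ M₂ ≠ 0 ∧
          (M₁.natDegree : ℝ) ≤ (N : ℝ) ^ δ ∧ (M₂.natDegree : ℝ) ≤ (N : ℝ) ^ δ ∧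
          (∀ i, (|M₁.coeff i| : ℝ) ≤ Real.exp ((N : ℝ) ^ σ)) ∧
          (∀ i, (|M₂.coeff i| : ℝ) ≤ Real.exp ((N : ℝ) ^ σ)) ∧
          0 < |aeval x M₁| ∧ |aeval x M₁| ≤ Real.exp (-(N : ℝ) ^ u) ∧
          0 < |aeval x M₂| ∧ |aeval x M₂| ≤ Real.exp (-(N : ℝ) ^ u) ∧
          ∀ z : ℂ, ¬ (aeval z M₁ = 0 ∧ aeval z M₂ = 0) := by
  -- the witness: x = Σ_k 2^{-a_k}, a_k = 2^(2^k)
  let a : ℕ → ℕ := fun k => 2 ^ (2 ^ k)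
  have h0 : a 0 = 2 := by simp [a]
  have hsq : ∀ k, a (k + 1) = a k ^ 2 := by intro k; simp only [a]; rw [pow_succ, pow_mul]
  have ha : StrictMono a := strictMono_of_sq_seq h0 hsq
  refine ⟨∑' j, ((1:ℝ) / 2) ^ a j, ?_⟩
  intro δ σ u hδ hσ hu H1 H3
  obtain ⟨N₀, hN₀⟩ := eventually_scale_conditions hδ hσ H1 H3
  refine ⟨N₀, fun N hN => ?_⟩
  obtain ⟨L0, L1, L2⟩ := hN₀ N hN
  have hc : 0 < Real.log 2 := Real.log_pos (by norm_num)
  set c := Real.log 2 with hc_def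
  set S := (N : ℝ) ^ σ with hS_def
  set U := (N : ℝ) ^ u with hU_def
  set E := (N : ℝ) ^ δ with hE_def
  have hS : 0 < S := by linarith
  have hU : 0 ≤ U := by positivity
  -- the scale
  have hR : 16 ≤ S / (4 * c) := by rw [le_div_iff₀ (by positivity)]; linarith
  have hR0 : 0 ≤ S / (4 * c) := by linarith
  obtain ⟨i, hBi, hAR, hRA⟩ := exists_scale h0 hsq hR
  set B : ℝ := (a i : ℝ) with hB_def
  set A : ℝ := (a (i + 1) : ℝ) with hA_def
  have hB4 : (4:ℝ) ≤ B := by rw [hB_def]; exact_mod_cast hBi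
  have hAB : A = B ^ 2 := by rw [hA_def, hB_def, hsq i]; push_cast; ring
  have hA2 : (a (i + 1 + 1) : ℝ) = A ^ 2 := by rw [hA_def, hsq (i + 1)]; push_cast; ring
  have hB0 : 0 < B := by linarith
  -- hypotheses of `scale_exponents`
  have h1 : 4 * A * c ≤ S := by
    have := hAR; rw [le_div_iff₀ (by positivity)] at this; linarith
  have hRB : (S / (4 * c)) ^ (4 : ℝ)⁻¹ ≤ B := by
    have hlt : S / (4 * c) ≤ B ^ 4 := by rw [hA2, hAB] at hRA; nlinarith
    have := Real.rpow_le_rpow hR0 hlt (by positivity : (0:ℝ) ≤ (4 : ℝ)⁻¹)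
    rwa [show ((4 : ℝ)⁻¹) = ((4 : ℕ) : ℝ)⁻¹ by norm_num,
      Real.pow_rpow_inv_natCast hB0.le (by norm_num)] at this
  have hRA' : (S / (4 * c)) ^ (2 : ℝ)⁻¹ ≤ A := by
    have hlt : S / (4 * c) ≤ A ^ 2 := by rw [hA2] at hRA; exact hRA.le
    have := Real.rpow_le_rpow hR0 hlt (by positivity : (0:ℝ) ≤ (2 : ℝ)⁻¹)
    rwa [show ((2 : ℝ)⁻¹) = ((2 : ℕ) : ℝ)⁻¹ by norm_num,
      Real.pow_rpow_inv_natCast (by linarith : (0:ℝ) ≤ A) (by norm_num)] at this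
  have h2 : 8 * U ≤ S * B := L1.trans (mul_le_mul_of_nonneg_left hRB hS.le)
  have h3 : 2 * U / (B ^ 2 * c) + 1 ≤ E := by
    have hRpos : 0 < (S / (4 * c)) ^ (2 : ℝ)⁻¹ := Real.rpow_pos_of_pos (by positivity) _
    have : 2 * U / (B ^ 2 * c) ≤ 2 * U / ((S / (4 * c)) ^ (2 : ℝ)⁻¹ * c) := by
      apply div_le_div_of_nonneg_left (by positivity) (by positivity)
      rw [← hAB]
      exact mul_le_mul_of_nonneg_right hRA' hc.le
    linarith
  obtain ⟨⟨j, hj1, hjE, hjS, hjU⟩, ⟨j', hj1', hjE', hjS', hjU'⟩⟩ :=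
    scale_exponents hS hU hB4 hAB h1 h2 h3
  -- the two witnesses
  have hq1 : ((2:ℤ) ^ a (i + 1)) ≠ 0 := pow_ne_zero _ two_ne_zero
  have hq2 : ((2:ℤ) ^ a i) ≠ 0 := pow_ne_zero _ two_ne_zero
  have W1 := linear_pow_witness (x := ∑' j, ((1:ℝ) / 2) ^ a j) (S := S) (U := U) hq1 hjE
    (abs_numerator_add_abs_denominator_le h0 ha (i + 1))
    (by push_cast; rw [← hA_def]; exact hjS) (linear_form_pos ha (i + 1))
    (by
      have hl := log_linear_form_le ha (i + 1)
      rw [hA2, ← hA_def] at hl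
      have hj0 : (0:ℝ) ≤ j := by positivity
      have := mul_le_mul_of_nonneg_left hl hj0
      nlinarith)
  have W2 := linear_pow_witness (x := ∑' j, ((1:ℝ) / 2) ^ a j) (S := S) (U := U) hq2 hjE'
    (abs_numerator_add_abs_denominator_le h0 ha i)
    (by push_cast; rw [← hB_def]; exact hjS') (linear_form_pos ha i)
    (by
      have hl := log_linear_form_le ha i
      rw [← hA_def, ← hB_def] at hl
      have hj0 : (0:ℝ) ≤ j' := by positivity
      have := mul_le_mul_of_nonneg_left hl hj0
      nlinarith)
  obtain ⟨n1, d1, c1, p1, s1⟩ := W1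
  obtain ⟨n2, d2, c2, p2, s2⟩ := W2
  refine ⟨_, _, n1, n2, d1, d2, c1, c2, p1, s1, p2, s2, ?_⟩
  exact linear_pow_no_common_root (by omega) (by omega) (numerators_cross_ne ha i).symm

/-- **Proposition NG″ (construction half)**, in the form announced in `paper/nogo.md` §6 (with the
redundant hypothesis (H2) `σ < 2δ`). One real number `x` such that, whenever `4(u-σ) < σ`,
`σ < 2δ`, `2(u-δ) < σ` (`δ, σ, u > 0`), every large scale `N` carries two non-zero integer
polynomials of degree `≤ N^δ`, coefficients `≤ exp(N^σ)` in absolute value, values at `x` in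
`(0, exp(-N^u)]` in absolute value, without common complex zero. Hence (θ = (x,1,…,1), trdeg ≤ 1)
no criterion reading only degrees, heights, sizes and zero-freeness of a family concludes
`trdeg ≥ l`, for any `l ≥ 2`, anywhere in that region — which contains Roy's whole window
(`royAdmissible_profile_nogo₂`, `SoloBlindProfileNoGoRankTwo.lean`). -/
theorem profile_nogo_rank_two_construction :
    ∃ x : ℝ, ∀ δ σ u : ℝ, 0 < δ → 0 < σ → 0 < u →
      4 * (u - σ) < σ → σ < 2 * δ → 2 * (u - δ) < σ →
      ∃ N₀ : ℕ, ∀ N : ℕ, N₀ ≤ N →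
        ∃ M₁ M₂ : ℤ[X],
          M₁ ≠ 0 ∧ M₂ ≠ 0 ∧
          (M₁.natDegree : ℝ) ≤ (N : ℝ) ^ δ ∧ (M₂.natDegree : ℝ) ≤ (N : ℝ) ^ δ ∧
          (∀ i, (|M₁.coeff i| : ℝ) ≤ Real.exp ((N : ℝ) ^ σ)) ∧
          (∀ i, (|M₂.coeff i| : ℝ) ≤ Real.exp ((N : ℝ) ^ σ)) ∧
          0 < |aeval x M₁| ∧ |aeval x M₁| ≤ Real.exp (-(N : ℝ) ^ u) ∧
          0 < |aeval x M₂| ∧ |aeval x M₂| ≤ Real.exp (-(N : ℝ) ^ u) ∧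
          ∀ z : ℂ, ¬ (aeval z M₁ = 0 ∧ aeval z M₂ = 0) := by
  obtain ⟨x, hx⟩ := profile_nogo_rank_two_construction'
  exact ⟨x, fun δ σ u hδ hσ hu H1 _ H3 => hx δ σ u hδ hσ hu H1 H3⟩

end Assembly

#harness_tags profile_nogo_rank_two_construction

end Summit.Schanuel.Schanuel.Theorems
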